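import Literature.NumberTheory.EllipticCurves.CasselsTateLocalTerms
import HarnessLib

/-!
# Symmetry of the local Weil cup product at a place where `E[m²]` is rational

Topic `NumberTheory/EllipticCurves`; namespace `Literature.NumberTheory.EllipticCurves`. Theorems only:
**no definition and no named fact is introduced** (D-0026).

Graded commutativity of the cup product in bidegree `(1, 1)`, in the one case the tree's Euler-system
files need and in a form provable from the inhomogeneous `2`-cocycle API (`ContinuousH2`:
`cupProduct_oneCocycleClass_eq_twoCocycleClass`, `twoCocycleClass_eq_zero_iff`):

* `cupProduct_comm_of_trivial_of_skew` — for a continuous equivariant pairing `φ : X × X → Z` of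
  topological `G`-modules with `G` acting TRIVIALLY on `X` and `φ` skew (`φ(x, y) = -φ(y, x)`), the cup
  product `H¹(G, X) × H¹(G, X) → H²(G, Z)` is SYMMETRIC: for crossed homomorphisms (= homomorphisms)
  `f, g`, `(f ∪ g − g ∪ f)(σ, τ) = φ(fσ, gτ) + φ(fτ, gσ)` is the coboundary of `σ ↦ −φ(fσ, gσ)`
  (`G` acts trivially on the values `φ(x, y) = φ(σx, σy) = σφ(x, y)`). This is the case `p = q = 1`
  of `a ∪ b = (−1)^{pq} t_*(b ∪ a)` for a skew pairing (Neukirch–Schmidt–Wingberg I §4), where the two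
  signs cancel.
* `weilLocalCup_comm_of_forall_smul_eq` — hence, at a `K`-field `F` whose absolute Galois group fixes
  `E[m²]` (a completion at a Kolyvagin prime of level `m²`, McCallum 1991 §4:
  `HeegnerPointsKolyvaginPrimaryLocalTrivialProofs`), the local Weil cup product of the Cassels–Tate
  files (`weilLocalCup`, alternating Weil pairing `e` on `E[m²]`) is symmetric:
  `x ∪ y = y ∪ x` in `H²(F, μ_{m²})`.

Use: the local term `inv_λ((loc_λ b₁ − β_λ) ∪ β'_λ)` of the Cassels–Tate pairing at a Kolyvagin prime
has its UNRAMIFIED class `β'_λ` in the second slot, while the tame cup-product computation (Gross 1991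
(7.6); x11b3's `TameCup.weilPairing_apply_eq_one_of_cupProduct_eq_zero`) takes it in the first; this
file swaps them.

## References

* [NeukirchSchmidtWingberg2008] J. Neukirch, A. Schmidt, K. Wingberg, *Cohomology of Number Fields*,
  2nd ed. (2008), Ch. I §4 (cup product, graded commutativity Prop. 1.4.4).
* [McCallumLMS1991] W. G. McCallum, *Kolyvagin's work on Shafarevich–Tate groups* (1991), §2, §4.
* [GrossLMS1991] B. H. Gross, *Kolyvagin's work on modular elliptic curves* (1991), §7 (7.2)–(7.6).
-/

noncomputable section

open scoped Classical

universe u v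

namespace Literature.NumberTheory.EllipticCurves

open CategoryTheory _root_.WeierstrassCurve Field
open Literature.NumberTheory.GaloisRepresentations Literature.NumberTheory.GaloisCohomology
open Literature.NumberTheory.GaloisRepresentations.DiscreteGaloisModule (mu MuCarrier pairing)
open scoped ContRepresentation

/-! ## Symmetry of the `(1,1)` cup product for a skew pairing on a trivial module -/

section Generic

variable {R : Type u} [CommRing R] [TopologicalSpace R] {G : Type v} [Group G] [TopologicalSpace G]
  [IsTopologicalGroup G] [LocallyCompactSpace G] {X Z : TopRep.{v} R G} (φ : ContPairing X X Z)

/-- **`[f] ∪ [g] = [g] ∪ [f]` for a skew pairing on a module with trivial action** (graded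
commutativity in bidegree `(1, 1)`, Neukirch–Schmidt–Wingberg I Prop. 1.4.4, the case where the
`G`-action on `X` is trivial: `f ∪ g − g ∪ f` is the coboundary of `σ ↦ −φ(fσ, gσ)`).
[cite: NeukirchSchmidtWingberg2008, I §4 Prop. 1.4.4] -/
theorem cupProduct_comm_of_trivial_of_skew (htriv : ∀ (σ : G) (x : X), X.ρ σ x = x)
    (hskew : ∀ x y : X, φ.toLin x y = -φ.toLin y x) (a b : continuousCohomology 1 X) :
    φ.cupProduct a b = φ.cupProduct b a := by
  obtain ⟨f, rfl⟩ := oneCocycleClass_surjective X a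
  obtain ⟨g, rfl⟩ := oneCocycleClass_surjective X b
  rw [ContPairing.cupProduct_oneCocycleClass_eq_twoCocycleClass,
    ContPairing.cupProduct_oneCocycleClass_eq_twoCocycleClass, ← sub_eq_zero, ← twoCocycleClass_sub,
    twoCocycleClass_eq_zero_iff]
  refine ⟨⟨fun σ => -φ.toLin (f.1 σ) (g.1 σ),
    (φ.continuous_toLin.comp (f.1.continuous.prodMk g.1.continuous)).neg⟩, fun σ τ => ?_⟩
  have hf : f.1 (σ * τ) = f.1 σ + f.1 τ := by rw [f.2 σ τ, htriv]
  have hg : g.1 (σ * τ) = g.1 σ + g.1 τ := by rw [g.2 σ τ, htriv]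
  have hZ : ∀ x y : X, Z.ρ σ (φ.toLin x y) = φ.toLin x y := fun x y => by
    rw [← φ.toLin_smul σ x y, htriv, htriv]
  change φ.toLin (f.1 σ) (g.1 (σ * τ) - g.1 σ) - φ.toLin (g.1 σ) (f.1 (σ * τ) - f.1 σ) =
    Z.ρ σ (-φ.toLin (f.1 τ) (g.1 τ)) - (-φ.toLin (f.1 (σ * τ)) (g.1 (σ * τ))) +
      (-φ.toLin (f.1 σ) (g.1 σ))
  rw [map_neg, hZ, hf, hg, add_sub_cancel_left, add_sub_cancel_left, hskew (g.1 σ) (f.1 τ)]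
  simp only [map_add, LinearMap.add_apply]
  abel

/-- An alternating biadditive pairing is skew: `B x y = -B y x`. [folklore] -/
private theorem skew_of_alternating {M N : Type*} [AddCommGroup M] [AddCommGroup N] (B : M →+ M →+ N)
    (halt : ∀ x, B x x = 0) (x y : M) : B x y = -B y x := by
  have h := halt (x + y)
  simp only [map_add, AddMonoidHom.add_apply, halt, zero_add, add_zero] at h
  rw [add_comm] at h
  exact eq_neg_of_add_eq_zero_left h

end Generic

/-! ## The local Weil cup product at a place where `E[m²]` is rational -/

section Local

variable {K : Type u} [Field K] (W : WeierstrassCurve K) (m : ℕ) [NeZero m]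
variable (E : Type u) [Field E] [Algebra K E]
variable (e : geomTorsion W ((m * m : ℕ) : ℤ) → geomTorsion W ((m * m : ℕ) : ℤ) → AlgebraicClosure K)
  (hμ : ∀ S T, e S T ^ (m * m) = 1)
  (hadd₁ : ∀ S₁ S₂ T, e (S₁ + S₂) T = e S₁ T * e S₂ T)
  (hadd₂ : ∀ S T₁ T₂, e S (T₁ + T₂) = e S T₁ * e S T₂)
  (hgal : ∀ (σ : absoluteGaloisGroup K) (S T : geomTorsion W ((m * m : ℕ) : ℤ)),
    σ • e S T = e (σ • S) (σ • T))

-- Cup products need `LocallyCompactSpace Γ`; as in the tree's cup-product files, the compactness of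
-- absolute Galois groups is a local instance only.
attribute [local instance] absoluteGaloisGroup_compactSpace

/-- **The local Weil cup product is symmetric where `E[m²]` is rational.** Over a `K`-field `F` whose
absolute Galois group fixes `E(K̄)[m²]` (through `res : Γ_F → Γ_K`), for an alternating Weil pairing
`e` on `E[m²]`: `x ∪ y = y ∪ x` in `H²(F, μ_{m²})` for all `x, y ∈ H¹(Γ_F, E[m²](K̄))`
(`cupProduct_comm_of_trivial_of_skew`). At a Kolyvagin prime `λ` of level `m²` this lets the tame
cup-product computation (Gross (7.6)) be applied with the unramified class in either slot.
[cite: NeukirchSchmidtWingberg2008, I §4 Prop. 1.4.4] [cite: McCallumLMS1991, §4] -/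
theorem weilLocalCup_comm_of_forall_smul_eq (halt : ∀ T, e T T = 1)
    (htriv : ∀ (g : absoluteGaloisGroup E) (P : geomTorsion W ((m * m : ℕ) : ℤ)),
      absGaloisRestrict K E g • P = P)
    (x y : galoisCohomology (GaloisRep.restrictField E (W.torsionGaloisModule ((m * m : ℕ) : ℤ))) 1) :
    weilLocalCup W m E e hμ hadd₁ hadd₂ hgal x y = weilLocalCup W m E e hμ hadd₁ hadd₂ hgal y x := by
  rw [weilLocalCup_apply, weilLocalCup_apply]
  refine cupProduct_comm_of_trivial_of_skew _ (fun g P => ?_) (fun S T => ?_) x y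
  · exact htriv g P
  · change weilPairingHom W (m * m) e hμ hadd₁ hadd₂ S T = -weilPairingHom W (m * m) e hμ hadd₁ hadd₂ T S
    exact skew_of_alternating _ (weilPairingHom_self W (m * m) e hμ hadd₁ hadd₂ halt) S T

end Local

/-! ## Appendix (2026-08-27): the same symmetry WITHOUT the trivial-action hypothesis

Graded commutativity of the cup product in bidegree `(1, 1)` for a skew pairing holds for an ARBITRARY continuous
action: with the tree's inhomogeneous formula `(f ∪ g)(σ, τ) = φ(fσ, g(στ) − gσ) = φ(fσ, σ·gτ)` and the crossed
homomorphism identities `f(στ) = fσ + σ·fτ`, `g(στ) = gσ + σ·gτ`, the cochain `h(σ) = −φ(fσ, gσ)` has coboundary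
`σ·h(τ) − h(στ) + h(σ) = −φ(σfτ, σgτ) + φ(fσ + σfτ, gσ + σgτ) − φ(fσ, gσ) = φ(fσ, σgτ) + φ(σfτ, gσ)`
(equivariance `φ(σx, σy) = σ·φ(x, y)` and bilinearity), which is `(f ∪ g − g ∪ f)(σ, τ)` by skewness
(`−φ(gσ, σfτ) = φ(σfτ, gσ)`). This is Neukirch–Schmidt–Wingberg I Prop. 1.4.4 in bidegree `(1,1)` in full; the
local Weil cup product is therefore symmetric at EVERY `K`-field, not only where `E[m²]` is rational (needed at
Bertolini–Darmon admissible primes, where `Frob²` acts on `E[p]` with eigenvalues `1, q² ≠ 1`: the isotropic lines of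
the resulting hyperbolic plane `H¹_fin ⊕ H¹_ord` are then exactly the two Lagrangian lines — the parity ∕ rank-raising
step of Gross–Parson and W. Zhang 2014 Lemma 5.3). [cite: NeukirchSchmidtWingberg2008, I §4 Prop. 1.4.4] -/

section GenericSkew

variable {R : Type u} [CommRing R] [TopologicalSpace R] {G : Type v} [Group G] [TopologicalSpace G]
  [IsTopologicalGroup G] [LocallyCompactSpace G] {X Z : TopRep.{v} R G} (φ : ContPairing X X Z)

/-- **`[f] ∪ [g] = [g] ∪ [f]` for a skew pairing, arbitrary continuous action** (graded commutativity in
bidegree `(1, 1)`, Neukirch–Schmidt–Wingberg I Prop. 1.4.4: `f ∪ g − g ∪ f` is the coboundary of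
`σ ↦ −φ(fσ, gσ)`; generalises `cupProduct_comm_of_trivial_of_skew`).
[cite: NeukirchSchmidtWingberg2008, I §4 Prop. 1.4.4] -/
theorem cupProduct_comm_of_skew (hskew : ∀ x y : X, φ.toLin x y = -φ.toLin y x)
    (a b : continuousCohomology 1 X) : φ.cupProduct a b = φ.cupProduct b a := by
  obtain ⟨f, rfl⟩ := oneCocycleClass_surjective X a
  obtain ⟨g, rfl⟩ := oneCocycleClass_surjective X b
  rw [ContPairing.cupProduct_oneCocycleClass_eq_twoCocycleClass,
    ContPairing.cupProduct_oneCocycleClass_eq_twoCocycleClass, ← sub_eq_zero, ← twoCocycleClass_sub,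
    twoCocycleClass_eq_zero_iff]
  refine ⟨⟨fun σ => -φ.toLin (f.1 σ) (g.1 σ),
    (φ.continuous_toLin.comp (f.1.continuous.prodMk g.1.continuous)).neg⟩, fun σ τ => ?_⟩
  have hf : f.1 (σ * τ) = f.1 σ + X.ρ σ (f.1 τ) := f.2 σ τ
  have hg : g.1 (σ * τ) = g.1 σ + X.ρ σ (g.1 τ) := g.2 σ τ
  have hZ : Z.ρ σ (φ.toLin (f.1 τ) (g.1 τ)) = φ.toLin (X.ρ σ (f.1 τ)) (X.ρ σ (g.1 τ)) :=
    (φ.toLin_smul σ (f.1 τ) (g.1 τ)).symm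
  change φ.toLin (f.1 σ) (g.1 (σ * τ) - g.1 σ) - φ.toLin (g.1 σ) (f.1 (σ * τ) - f.1 σ) =
    Z.ρ σ (-φ.toLin (f.1 τ) (g.1 τ)) - (-φ.toLin (f.1 (σ * τ)) (g.1 (σ * τ))) +
      (-φ.toLin (f.1 σ) (g.1 σ))
  rw [map_neg, hZ, hf, hg, add_sub_cancel_left, add_sub_cancel_left, hskew (g.1 σ) (X.ρ σ (f.1 τ))]
  simp only [map_add, LinearMap.add_apply]
  abel

end GenericSkew

section LocalGeneral

variable {K : Type u} [Field K] (W : WeierstrassCurve K) (m : ℕ) [NeZero m]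
variable (E : Type u) [Field E] [Algebra K E]
variable (e : geomTorsion W ((m * m : ℕ) : ℤ) → geomTorsion W ((m * m : ℕ) : ℤ) → AlgebraicClosure K)
  (hμ : ∀ S T, e S T ^ (m * m) = 1)
  (hadd₁ : ∀ S₁ S₂ T, e (S₁ + S₂) T = e S₁ T * e S₂ T)
  (hadd₂ : ∀ S T₁ T₂, e S (T₁ + T₂) = e S T₁ * e S T₂)
  (hgal : ∀ (σ : absoluteGaloisGroup K) (S T : geomTorsion W ((m * m : ℕ) : ℤ)),
    σ • e S T = e (σ • S) (σ • T))

attribute [local instance] absoluteGaloisGroup_compactSpace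

/-- **The local Weil cup product is symmetric at every `K`-field `F`** (no rationality of `E[m²]` needed):
`x ∪ y = y ∪ x` in `H²(F, μ_{m²})` for all `x, y ∈ H¹(Γ_F, E[m²](K̄))`, for an alternating Weil pairing `e`
(`cupProduct_comm_of_skew`; strengthens `weilLocalCup_comm_of_forall_smul_eq`).
[cite: NeukirchSchmidtWingberg2008, I §4 Prop. 1.4.4] [cite: McCallumLMS1991, §4] -/
theorem weilLocalCup_comm (halt : ∀ T, e T T = 1)
    (x y : galoisCohomology (GaloisRep.restrictField E (W.torsionGaloisModule ((m * m : ℕ) : ℤ))) 1) :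
    weilLocalCup W m E e hμ hadd₁ hadd₂ hgal x y = weilLocalCup W m E e hμ hadd₁ hadd₂ hgal y x := by
  rw [weilLocalCup_apply, weilLocalCup_apply]
  refine cupProduct_comm_of_skew _ (fun S T => ?_) x y
  change weilPairingHom W (m * m) e hμ hadd₁ hadd₂ S T = -weilPairingHom W (m * m) e hμ hadd₁ hadd₂ T S
  exact skew_of_alternating _ (weilPairingHom_self W (m * m) e hμ hadd₁ hadd₂ halt) S T

end LocalGeneral

end Literature.NumberTheory.EllipticCurves

end
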